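import Summits.BirchSwinnertonDyer.Rank1Residual.ManinAdditive.ShimuraFiveEleven
import HarnessLib

/-!
# The residual of E-es-224 after the bad-prime sieve (cell bsd-f2-manin, es g43 ROAD γ; MEMO-es §66): `ShimuraFiveOnlyAtEleven ⟺
# (no `25` in the level) ∧ (Byeon–Kim's squarefree case)`

Cell bsd-f2-manin, seat es (planner), gen 43.  Typed rows over tree declarations; NOTHING is asserted — every row is an `@[conjecture] def … : Prop`.
Rows E-es-226/229/230 are THEOREMS (closed by name in `Theorems/ManinLocalTwoThreeShimuraFiveResidualHolds.lean` from
`Theorems/ManinLocalTwoThreeShimuraIndexBadPrimeSieve.lean`, decls `ShimuraSieve.level_profile_five_datum` / `…level_profile_five_of_squarefree'` /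
`…level_coprime_fortytwo`; `_holds` terms in the docstrings);
rows E-es-227 / E-es-228 are the two CONJECTURAL halves of E-es-224 `ShimuraFiveOnlyAtEleven` (this file proves the edges
`shimuraFiveOnlyAtEleven_of_levelProfile : E-es-226 → E-es-227 → E-es-228 → E-es-224` and the two converses by elementary arithmetic;
the Holds file makes the decomposition unconditional); rows E-es-229 (squarefree profile, hopt-free) and E-es-230 (`(N,42) = 1`, any newform) are THEOREMS too:
E-es-228 is Byeon–Kim 2014, Thm. 1.1 in the `Λ₀/Λ₁` currency (print modulo the `E₀/E₁ ↔ Λ₀/Λ₁` dictionary; its Diophantine step = Hadano's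
Tate-normal-form analysis), E-es-227 (`25 ∤ N`) is the half NOT located in print.  `hopt` = LATTICE-optimality of the `X₀(N)`-datum.

Falsifier (HOME/es/g43/E226-sieve-check-g43.txt; E15 table 0f2795b49f3ad4a5, 1025 optimal classes, `N ≤ 19870`): the sieve law behind E-es-226
(`ℓ ∣ n ⟹ p² ∣ N → p = ℓ`, `p ∥ N → ℓ ∣ p − a_p`) at 99 pairs (class, prime `ℓ ∣ n`): `ℓ = 2`: 75, `ℓ = 3`: 23, `ℓ = 5`: 1 — 0 violations; one split
prime per class (THEOREM AL) — 0 violations; E-es-227/228: `5 ∣ n` only at 11a1 (`N = 11`: `25 ∤ 11`, squarefree) — consistent, 1/1025.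
[cite: ByeonKim2014, Thm. 1.1 and Prop. 4.1] [cite: LingOesterle1991, Thm. 6] [cite: AtkinLehner1970, Thm. 3] [cite: Vatsal2005, Rem. 1.8]
-/

set_option autoImplicit false

noncomputable section

open scoped MatrixGroups ModularForm

open CongruenceSubgroup Complex WeierstrassCurve Literature.NumberTheory.EllipticCurves
  Literature.NumberTheory.EllipticCurves.ModularForms
open Summit.BirchSwinnertonDyer.Rank1Residual.ManinAdditive Summit.BirchSwinnertonDyer.Rank1Residual.ManinAdditive.KatoCurve

namespace Summit.BirchSwinnertonDyer.Rank1Residual.ManinAdditive.EsG43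

/-- **E-es-226 `ShimuraFiveLevelProfile`** (THEOREM, T-es-85: `_holds := fun W₀ _ _ _ _ D₀ hopt hS _ hp hpN ↦
ShimuraSieve.level_profile_five_datum W₀ D₀ hopt hS hp hpN`).  THE LEVEL PROFILE of a `5` in the Shimura-cover kernel of a lattice-optimal
`X₀(N)`-datum of a minimal `W₀`: every prime `p ∣ N` is `5` (then `25 ∣ N`), or `11` (simple and split: `11² ∤ N`, `a₁₁(f) = +1`), or a simple
NON-SPLIT prime `p ≡ −1 (mod 5)` (`a_p(f) = −1`) — i.e. `N = 5^e·11·∏pᵢ`, `e ≠ 1`, `pᵢ ≡ 4 (mod 5)`.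
[cite: LingOesterle1991, Thm. 6] [cite: AtkinLehner1970, Thm. 3] [cite: ByeonKim2014, Prop. 4.1] -/
@[conjecture]
def ShimuraFiveLevelProfile : Prop :=
  ∀ (W₀ : WeierstrassCurve ℚ) [W₀.IsElliptic] [W₀.IsGloballyMinimal] {N : ℕ} [NeZero N]
    (D₀ : ModularParametrizationData W₀ N), (∀ z ∈ D₀.L.lattice, ∃ w ∈ periodLattice D₀.f, z = D₀.c * w) →
    ¬ ShimuraIndexPrimeTo 5 D₀.f → ∀ p : ℕ, p.Prime → p ∣ N →
      (p = 5 ∧ 25 ∣ N) ∨ (p = 11 ∧ ¬ 11 ^ 2 ∣ N ∧ cuspCoeff D₀.f 11 = 1) ∨ (p % 5 = 4 ∧ ¬ p ^ 2 ∣ N ∧ cuspCoeff D₀.f p = -1)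

/-- **E-es-227 `ShimuraFiveNoTwentyFive`** (CONJECTURAL beyond print; nothing asserted).  The half of E-es-224 the sieve cannot reach: a `5` in the
Shimura-cover kernel of a lattice-optimal `X₀(N)`-datum forces `25 ∤ N` (equivalently, by E-es-226, `5 ∤ N`, i.e. `N` squarefree).  Why it might
fail: an optimal curve of level `25·11·M` with `W[5] ≅ ℤ/5 ⊕ μ₅` (additive at `5`, e.g. a quadratic twist by `5` of a curve in Byeon–Kim's family)
whose `μ₅` lies in the Shimura subgroup. [cite: ByeonKim2014, Thm. 1.1] [cite: Vatsal2005, Rem. 1.8] -/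
@[conjecture]
def ShimuraFiveNoTwentyFive : Prop :=
  ∀ (W₀ : WeierstrassCurve ℚ) [W₀.IsElliptic] [W₀.IsGloballyMinimal] {N : ℕ} [NeZero N]
    (D₀ : ModularParametrizationData W₀ N), (∀ z ∈ D₀.L.lattice, ∃ w ∈ periodLattice D₀.f, z = D₀.c * w) →
    ¬ ShimuraIndexPrimeTo 5 D₀.f → ¬ 25 ∣ N

/-- **E-es-228 `ShimuraFiveSquarefreeOnlyAtEleven`** (CONJECTURAL here; IN PRINT modulo the `E₀/E₁ ↔ Λ₀/Λ₁` dictionary as Byeon–Kim 2014,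
Thm. 1.1: «`N` squarefree, `5 ∤ N`, `C(ℚ)[5] ≠ 0` ⟹ (`A[5] ↪ Σ(N)` ⟺ `N = 11`)»; by E-es-226 the printed proviso `5 ∤ N` is automatic).  At
squarefree level a `5` in the Shimura-cover kernel of a lattice-optimal datum occurs only at `N = 11`.  Why it might fail (as a formal target):
the Diophantine step (Hadano: integral points on the Tate normal form with `Δ = u⁵v⁵(u² − 11uv − v²)` a product of the primes `11, pᵢ`) has no
tree counterpart. [cite: ByeonKim2014, Thm. 1.1 and §3] -/
@[conjecture]
def ShimuraFiveSquarefreeOnlyAtEleven : Prop :=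
  ∀ (W₀ : WeierstrassCurve ℚ) [W₀.IsElliptic] [W₀.IsGloballyMinimal] {N : ℕ} [NeZero N]
    (D₀ : ModularParametrizationData W₀ N), (∀ z ∈ D₀.L.lattice, ∃ w ∈ periodLattice D₀.f, z = D₀.c * w) →
    Squarefree N → ¬ ShimuraIndexPrimeTo 5 D₀.f → N = 11

/-- **E-es-229 `ShimuraFiveSquarefreeLevelProfile`** (THEOREM, T-es-85: `_holds := fun W _ _ _ _ D hsq hS _ hp hpN ↦
ShimuraSieve.level_profile_five_of_squarefree' W D hsq hS hp hpN`).  E-es-226 at SQUAREFREE level, with NO lattice-optimality binder (ROAD β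
transported through the Néron lattice): `5 ∤ N`, `11 ∣ N` with `a₁₁(f) = +1`, and every prime `p ∣ N` other than `11` is `≡ −1 (mod 5)` with
`a_p(f) = −1` — the shape `N = 11·∏pᵢ` of Byeon–Kim, Prop. 4.1, here for the `Λ₀/Λ₁` kernel and without their provisos `5 ∤ N`, `C(ℚ)[5] ≠ 0`.
[cite: ByeonKim2014, Prop. 4.1] [cite: LingOesterle1991, Thm. 6] [cite: AtkinLehner1970, Thm. 3] -/
@[conjecture]
def ShimuraFiveSquarefreeLevelProfile : Prop :=
  ∀ (W : WeierstrassCurve ℚ) [W.IsElliptic] [W.IsGloballyMinimal] {N : ℕ} [NeZero N]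
    (D : ModularParametrizationData W N), Squarefree N → ¬ ShimuraIndexPrimeTo 5 D.f → ∀ p : ℕ, p.Prime → p ∣ N →
      ¬ 5 ∣ N ∧ 11 ∣ N ∧ cuspCoeff D.f 11 = 1 ∧ (p = 11 ∨ (p % 5 = 4 ∧ cuspCoeff D.f p = -1))

/-- **E-es-230 `ShimuraFiveLevelCoprimeFortyTwo`** (THEOREM, T-es-85: `_holds := fun _ _ _ hf hS ↦ ShimuraSieve.level_coprime_fortytwo hf hS`).
For ANY newform `f ∈ S₂(Γ₀(N))` (no curve, no datum): a `5` in `[Λ₀(f) : Λ₁(f)]` forces `(N, 42) = 1` and `5 ∣ N ⟹ 25 ∣ N` (no prime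
`≡ ±2 (mod 5)` divides `N`; `5 ∥ N` is impossible). [cite: LingOesterle1991, Thm. 6] [cite: AtkinLehner1970, Thm. 3] -/
@[conjecture]
def ShimuraFiveLevelCoprimeFortyTwo : Prop :=
  ∀ {N : ℕ} [NeZero N] (f : CuspForm (Gamma0 N) 2), IsNewform0 f → ¬ ShimuraIndexPrimeTo 5 f →
    ¬ 2 ∣ N ∧ ¬ 3 ∣ N ∧ ¬ 7 ∣ N ∧ (5 ∣ N → 25 ∣ N)

/-- E-es-224 gives E-es-227 (`25 ∤ 11`). -/
theorem shimuraFiveNoTwentyFive_of_onlyAtEleven (h : ShimuraFiveOnlyAtEleven) : ShimuraFiveNoTwentyFive := by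
  intro W₀ _ _ N _ D₀ hopt hS
  rw [h W₀ D₀ hopt hS]
  norm_num

/-- E-es-224 gives E-es-228. -/
theorem shimuraFiveSquarefreeOnlyAtEleven_of_onlyAtEleven (h : ShimuraFiveOnlyAtEleven) : ShimuraFiveSquarefreeOnlyAtEleven :=
  fun W₀ _ _ _ _ D₀ hopt _ hS ↦ h W₀ D₀ hopt hS

/-- **The decomposition.**  Given the level profile E-es-226, E-es-227 and E-es-228 together give E-es-224: `25 ∤ N` and the profile make `N`
squarefree, and then E-es-228 applies. -/
theorem shimuraFiveOnlyAtEleven_of_levelProfile (hprof : ShimuraFiveLevelProfile) (h25 : ShimuraFiveNoTwentyFive)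
    (hsq : ShimuraFiveSquarefreeOnlyAtEleven) : ShimuraFiveOnlyAtEleven := by
  intro W₀ _ _ N _ D₀ hopt hS
  refine hsq W₀ D₀ hopt ?_ hS
  rw [Nat.squarefree_iff_prime_squarefree]
  intro p hp hpp
  rcases hprof W₀ D₀ hopt hS p hp ((dvd_mul_right p p).trans hpp) with ⟨-, h⟩ | ⟨rfl, h, -⟩ | ⟨-, h, -⟩
  · exact h25 W₀ D₀ hopt hS h
  · exact h (by simpa [sq] using hpp)
  · exact h (by simpa [sq] using hpp)

end Summit.BirchSwinnertonDyer.Rank1Residual.ManinAdditive.EsG43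

end
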